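import Literature.NumberTheory.EllipticCurves.MordellCurveSupersingular
import Literature.NumberTheory.EllipticCurves.MordellCurveKodairaThreeProofs
import Literature.NumberTheory.EllipticCurves.MordellCurveTateAlgorithmTwoProofs
import Literature.NumberTheory.EllipticCurves.CongruentNumberCurveAdditiveReduction
import Literature.NumberTheory.EllipticCurves.LFunctionSmulProofs
import Literature.NumberTheory.DiophantineGeometry.TateAlgorithmAdditiveProofs
import HarnessLib

/-!
# The Dirichlet coefficients of `L(E^k, s)`, `E^k : y² = x³ + k`, at prime powers (Ireland–Rosen Ch. 18 §§3, 7)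

Topic `Literature/NumberTheory/EllipticCurves`, namespace `Literature.NumberTheory.EllipticCurves.SexticTwist`.
Theorems only (no definition, no named fact).  The `j = 0` twin of `QuarticTwistLSeriesCoefficients` (which treats
`y² = x³ − Dx` over `ℤ[i]`): for Mathlib's `WeierstrassCurve.LFunction` of the Mordell curve
`E^k = mordellCurve k = ⟨0, 0, 0, 0, k⟩ / ℚ` (`k ∈ ℤ ∖ 0` free of sixth powers where this matters; `Δ = −2⁴3³k²`, `c₄ = 0`,
`c₆ = −2⁵3³k`),

* §1 the model (`c₆`, integrality, the `ℤ`-model);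
* §2 **additive primes**: every prime `p` with `0 < ord_p(432 k²) < 12` (Silverman VII.5.1(c) with VII.1.1: the equation is
  minimal and `p ∣ Δ`, `p ∣ c₄ = 0`) — this covers `p ≥ 5` with `p ∣ k`, `p⁶ ∤ k`; `p = 3` with `3⁵ ∤ k`; `p = 2` with `2⁴ ∤ k` —
  and the three remaining sixth-power-free cells `3⁵ ∥ k`, `2⁵ ∥ k`, `k = 16u` with `u ≡ 3 (4)` by the tree's Tate algorithm
  (Kodaira type `II*`, `MordellCurveKodairaThreeProofs` / `MordellCurveTateAlgorithmTwoProofs`, read through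
  `isAdditive_kodairaSymbolAt_iff`); at all of them `a_{p^{j+1}}(E^k) = 0` (Ireland–Rosen: «if `P ∣ 6D` define `χ(P) = 0`»);
* §3 **inert primes** `p ≡ 2 (3)`, `p ≠ 2`, `p ∤ k`: `a_p = 0` (Theorem 4, first assertion — the tree's
  `lFunction_mordellCurve_apply_prime_eq_zero`), `a_{p^{2m}} = (−p)^m`, `a_{p^{2m+1}} = 0` (`χ((p)) = −p`); and the one
  sixth-power-free cell of GOOD reduction at `2`, `k = 16u`, `u ≡ 1 (4)` (minimal model `y² + y = x³ + (u − 1)/4`, the tree's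
  `hasGoodReductionAt_mordell_four_of_emod_four_eq_one`): `a_2 = 0` by the count `#Ẽ(𝔽₂) = 3`, so again `a_{4^m} = (−2)^m`,
  `a_{2·4^m} = 0` (the prime `2` is inert in `ℤ[ω]`);
* §4 (sequel `SexticTwistLSeriesCoefficientsSplit`) **split primes** `p ≡ 1 (3)`: `a_p(E^k) = σ(χ) + \overline{σ(χ)}`,
  `χ = (k/p) · (4k/𝔭)₃ · ϖ_𝔭` — Ireland–Rosen's Theorem 18.4.

These are the Euler factors of Ireland–Rosen's «`L(E, s) = L(s, χ)`» for `y² = x³ + D` (Ch. 18 §7) read on Mathlib's arithmetic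
function `n ↦ a_n(E^k)`, including the primes above `2` and `3` that the printed `L(E, s) = ∏_{p ∤ Δ}` omits; the regrouping
into a sum over the ideals of `ℤ[ω]` is done in the sequel `SexticTwistHeckeCoefficients`.  Filed for the BED route of
`Summits/BirchSwinnertonDyer` (crux `ManinDatumSupercuspidalCMInert`, stub `S5`: the `ℤ[ω]` dictionary of the hypothesis `H₅` of
`…CMInertStubsOfModelLValues`); nothing about BSD is proved here.

## References
* K. Ireland, M. Rosen, *A Classical Introduction to Modern Number Theory*, 2nd ed., GTM 84 (1990), Ch. 18 §3 Theorem 4 and its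
  proof, §7 (`L(E, s) = L(s, χ)` for `y² = x³ + D`) (PDF pp. 298–299, 305–306); Ch. 9 §4 Lemma 1. [IrelandRosen1990]
* J. H. Silverman, *The Arithmetic of Elliptic Curves*, 2nd ed. (2009), VII.1 Remark 1.1, VII.5 Prop. 5.1, §C.16. [SilvermanAEC2009]
* J. H. Silverman, *Advanced Topics in the Arithmetic of Elliptic Curves* (1994), IV.9.4 and Table 4.1. [SilvermanATAEC1994]
* F. Diamond, J. Shurman, *A First Course in Modular Forms*, GTM 228, §8.8 (8.44). [DiamondShurman2005]

## Mathlib / tree search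
Tree: `mordellCurve`, `mordellCurve_Δ`, `mordellCurve_c₄`, `map_mordellCurve`, `isElliptic_mordellCurve` (`MordellCurveThreeDescent`);
`lFunction_mordellCurve_apply_prime_eq_zero`, `not_dvd_mordellCurve_Δ` (`MordellCurveSupersingular`); `hasAdditiveReductionAt_of_valuation`,
`lFunction_apply_eq_zero_of_hasAdditiveReductionAt` (`CongruentNumberCurveAdditiveReduction`); `hasGoodReductionAt_map_of_not_dvd`;
`Automorphic.lFunction_map_apply_prime_of_not_dvd/frobeniusTrace/numPointsMod`; `LFunction_apply_prime_pow_add_two`,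
`isMultiplicative_LFunction`; `LFunction_smul`; `Mordell.kodairaSymbolAt_three_of_mordell_five`,
`kodairaSymbolAt_and_ordMinimalDiscriminant_mordell_four_of_emod_four_eq_three/_five`, `hasGoodReductionAt_mordell_four_of_emod_four_eq_one`,
`isAdditive_kodairaSymbolAt_iff_holds`.  Mathlib: `WeierstrassCurve.Affine.nonsingularPointEquiv`, `equation_iff_nonsingular_of_Δ_ne_zero`.
No Euler-factor statement for `y² = x³ + k` beyond `a_p = 0` (inert) existed (`lean search 'mordellCurve.*LFunction'`).
-/

noncomputable section

open scoped Classical ComplexConjugate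

open WeierstrassCurve IsDedekindDomain NumberField Rat.HeightOneSpectrum Finset
open Literature.NumberTheory.GaloisRepresentations Literature.NumberTheory.DiophantineGeometry

namespace Literature.NumberTheory.EllipticCurves

namespace SexticTwist

variable {k : ℤ}

/-! ### §1 The model `E^k = ⟨0, 0, 0, 0, k⟩` -/

/-- `mordellCurve k` is the literal model `⟨0, 0, 0, 0, k⟩` («the elliptic curve `y² = x³ + D`»). [cite: IrelandRosen1990, Ch. 18 §3 (PDF p. 298)] -/
theorem mordellCurve_eq (k : ℚ) : mordellCurve k = (⟨0, 0, 0, 0, k⟩ : WeierstrassCurve ℚ) := rfl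

/-- The `ℤ`-model `mordellCurve k` (`D ∈ ℤ`) base-changes to `mordellCurve (k : ℚ)` («`y² = x³ + D`, `D ∈ ℤ`, defined over `ℚ`»).
[cite: IrelandRosen1990, Ch. 18 §3 (PDF p. 298)] -/
theorem map_mordellCurve_intCast (k : ℤ) :
    (mordellCurve k).map (Int.castRingHom ℚ) = mordellCurve (k : ℚ) := by
  rw [map_mordellCurve, eq_intCast]

/-- The `ℤ`-model `mordellCurve k` reduces modulo `p` to `mordellCurve (k : ZMod p)` («consider the reduced curve `E_p` over `ℤ/pℤ`»).
[cite: IrelandRosen1990, Ch. 18 §3 (PDF p. 298)] -/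
theorem map_mordellCurve_zmod (k : ℤ) (p : ℕ) :
    (mordellCurve k).map (Int.castRingHom (ZMod p)) = mordellCurve (k : ZMod p) := by
  rw [map_mordellCurve, eq_intCast]

/-- `c₆(E^k) = −864 k`. [cite: SilvermanAEC2009, III.1 (formulas for `c₆`)] -/
theorem mordellCurve_c₆ {R : Type*} [CommRing R] (k : R) : (mordellCurve k).c₆ = -864 * k := by
  simp only [mordellCurve, WeierstrassCurve.c₆, WeierstrassCurve.b₂, WeierstrassCurve.b₄, WeierstrassCurve.b₆]
  ring

/-- `Δ(E^k) = −432 k²` over `ℚ`. [cite: IrelandRosen1990, Ch. 18 §3 (PDF p. 298)] -/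
theorem Δ_rat (k : ℤ) : (mordellCurve (k : ℚ)).Δ = -(432 * (k : ℚ) ^ 2) := mordellCurve_Δ _

/-- `k = p^e · m` with `p ∤ m`, for `k ≠ 0`. [folklore] -/
private theorem exists_eq_pow_mul_not_dvd (hk : k ≠ 0) {p : ℕ} (hp : p.Prime) :
    ∃ (e : ℕ) (m : ℤ), k = (p : ℤ) ^ e * m ∧ ¬ (p : ℤ) ∣ m := by
  obtain ⟨e, n', hn', hkn⟩ := Nat.exists_eq_pow_mul_and_not_dvd (Int.natAbs_ne_zero.mpr hk) p hp.ne_one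
  have hn'' : ¬ (p : ℤ) ∣ (n' : ℤ) := by exact_mod_cast hn'
  rcases Int.natAbs_eq k with h | h
  · refine ⟨e, n', ?_, hn''⟩
    conv_lhs => rw [h, hkn]
    push_cast; ring
  · refine ⟨e, -n', ?_, by rwa [dvd_neg]⟩
    conv_lhs => rw [h, hkn]
    push_cast
    ring

/-- The exponent of `p` in `k = p^e m`, `p ∤ m`, is at most `5` when `p⁶ ∤ k`. [folklore] -/
private theorem exp_le_five_of_not_pow_six_dvd {p : ℕ} {e : ℕ} {m : ℤ} (hke : k = (p : ℤ) ^ e * m)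
    (h6 : ¬ (p : ℤ) ^ 6 ∣ k) : e ≤ 5 := by
  by_contra h
  exact h6 (hke ▸ (pow_dvd_pow _ (by omega)).mul_right m)

/-! ### §2 The additive primes -/

section Additive

variable (v : HeightOneSpectrum (𝓞 ℚ))

/-- **Additive reduction of `E^k` from `0 < ord_p Δ < 12`**: if `k = p^e m` with `p ∤ m` and
`0 < ord_p(432) + 2e < 12` (so the equation `y² = x³ + k` is `p`-integral and minimal with `p ∣ Δ = −432k²` and
`p ∣ c₄ = 0`), then `E^k` has additive reduction at `p` (Silverman VII.1 Remark 1.1, VII.5 Prop. 5.1(c)).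
[cite: SilvermanAEC2009, VII.5 Prop. 5.1(c) and VII.1 Remark 1.1] -/
theorem hasAdditiveReductionAt_of_valuation_Δ {e : ℕ} {m : ℤ} (hke : k = (natGenerator v : ℤ) ^ e * m)
    (hm : ¬ (natGenerator v : ℤ) ∣ m) {c : ℕ} {m' : ℤ} (h432 : (432 : ℤ) = (natGenerator v : ℤ) ^ c * m')
    (hm' : ¬ (natGenerator v : ℤ) ∣ m') (hpos : 0 < c + 2 * e) (hlt : c + 2 * e < 12) :
    (mordellCurve (k : ℚ)).HasAdditiveReductionAt v := by
  have hvm : v.valuation ℚ (m : ℚ) = 1 := Rat.valuation_intCast_eq_one v hm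
  have hvm' : v.valuation ℚ (m' : ℚ) = 1 := Rat.valuation_intCast_eq_one v hm'
  have hvk : v.valuation ℚ (k : ℚ) = WithZero.exp (-(e : ℤ)) := by
    rw [hke]; push_cast
    rw [Valuation.map_mul, Valuation.map_pow, Rat.valuation_natGenerator, hvm, mul_one, ← WithZero.exp_nsmul]
    simp
  have hv432 : v.valuation ℚ (432 : ℚ) = WithZero.exp (-(c : ℤ)) := by
    have : (432 : ℚ) = ((432 : ℤ) : ℚ) := by norm_num
    rw [this, h432]; push_cast
    rw [Valuation.map_mul, Valuation.map_pow, Rat.valuation_natGenerator, hvm', mul_one, ← WithZero.exp_nsmul]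
    simp
  have hΔ : v.valuation ℚ (mordellCurve (k : ℚ)).Δ = WithZero.exp (-(c + 2 * e : ℤ)) := by
    rw [Δ_rat, Valuation.map_neg, Valuation.map_mul, Valuation.map_pow, hv432, hvk, ← WithZero.exp_nsmul,
      ← WithZero.exp_add]
    congr 1; ring
  refine hasAdditiveReductionAt_of_valuation v _ (by simp [mordellCurve]) (by simp [mordellCurve])
    (by simp [mordellCurve]) (by simp [mordellCurve]) ?_ ?_ ?_ ?_
  · show v.valuation ℚ (k : ℚ) ≤ 1
    rw [Rat.valuation_intCast]; exact HeightOneSpectrum.intValuation_le_one _ _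
  · rw [hΔ, WithZero.exp_lt_exp]; omega
  · rw [hΔ, ← WithZero.exp_zero, WithZero.exp_lt_exp]; omega
  · rw [mordellCurve_c₄, Valuation.map_zero]; exact zero_lt_one

/-- **`E^k` has additive reduction at every prime `p ≥ 5` with `p ∣ k`, `p⁶ ∤ k`** (`ord_p Δ = 2 ord_p k ∈ (0, 12)`).
[cite: SilvermanAEC2009, VII.5 Prop. 5.1(c) and VII.1 Remark 1.1] [cite: IrelandRosen1990, Ch. 18 §7 («if `P ∣ 6D` then `χ(P) = 0`»)] -/
theorem hasAdditiveReductionAt_of_five_le (hk : k ≠ 0) (h5 : 5 ≤ natGenerator v) (hpk : (natGenerator v : ℤ) ∣ k)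
    (h6 : ¬ (natGenerator v : ℤ) ^ 6 ∣ k) : (mordellCurve (k : ℚ)).HasAdditiveReductionAt v := by
  have hp := prime_natGenerator v
  obtain ⟨e, m, hke, hm⟩ := exists_eq_pow_mul_not_dvd hk hp
  have he1 : 1 ≤ e := by
    by_contra h0
    have : e = 0 := by omega
    subst this
    rw [pow_zero, one_mul] at hke
    exact hm (hke ▸ hpk)
  have he5 := exp_le_five_of_not_pow_six_dvd hke h6
  have h432 : ¬ (natGenerator v : ℤ) ∣ 432 := by
    intro h
    have h' : natGenerator v ∣ 2 ^ 4 * 3 ^ 3 := by exact_mod_cast h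
    rcases (Nat.Prime.dvd_mul hp).mp h' with h2 | h3
    · have := (Nat.prime_dvd_prime_iff_eq hp Nat.prime_two).mp (hp.dvd_of_dvd_pow h2); omega
    · have := (Nat.prime_dvd_prime_iff_eq hp Nat.prime_three).mp (hp.dvd_of_dvd_pow h3); omega
  exact hasAdditiveReductionAt_of_valuation_Δ v hke hm (c := 0) (m' := 432) (by ring) h432 (by omega) (by omega)

/-- **`E^k` has additive reduction at `3` whenever `3⁵ ∤ k`** (`k ≠ 0`; `ord₃ Δ = 3 + 2 ord₃ k ∈ (0, 12)`, `c₄ = 0`).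
[cite: SilvermanAEC2009, VII.5 Prop. 5.1(c) and VII.1 Remark 1.1] -/
theorem hasAdditiveReductionAt_three_of_not_dvd (hk : k ≠ 0) (hv : natGenerator v = 3) (h5 : ¬ (3 : ℤ) ^ 5 ∣ k) :
    (mordellCurve (k : ℚ)).HasAdditiveReductionAt v := by
  obtain ⟨e, m, hke, hm⟩ := exists_eq_pow_mul_not_dvd hk Nat.prime_three
  have he4 : e ≤ 4 := by
    by_contra h
    exact h5 (hke ▸ (pow_dvd_pow _ (by omega)).mul_right m)
  rw [← hv] at hke hm
  refine hasAdditiveReductionAt_of_valuation_Δ v hke hm (c := 3) (m' := 16) (by rw [hv]; norm_num) ?_ (by omega)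
    (by omega)
  rw [hv]; norm_num

/-- **`E^k` has additive reduction at `2` whenever `2⁴ ∤ k`** (`k ≠ 0`; `ord₂ Δ = 4 + 2 ord₂ k ∈ (0, 12)`, `c₄ = 0`).
[cite: SilvermanAEC2009, VII.5 Prop. 5.1(c) and VII.1 Remark 1.1] -/
theorem hasAdditiveReductionAt_two_of_not_dvd (hk : k ≠ 0) (hv : natGenerator v = 2) (h4 : ¬ (2 : ℤ) ^ 4 ∣ k) :
    (mordellCurve (k : ℚ)).HasAdditiveReductionAt v := by
  obtain ⟨e, m, hke, hm⟩ := exists_eq_pow_mul_not_dvd hk Nat.prime_two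
  have he3 : e ≤ 3 := by
    by_contra h
    exact h4 (hke ▸ (pow_dvd_pow _ (by omega)).mul_right m)
  rw [← hv] at hke hm
  refine hasAdditiveReductionAt_of_valuation_Δ v hke hm (c := 4) (m' := 27) (by rw [hv]; norm_num) ?_ (by omega)
    (by omega)
  rw [hv]; norm_num

/-- Kodaira type `II*` is an additive type, hence additive reduction (`isAdditive_kodairaSymbolAt_iff`).
[cite: SilvermanATAEC1994, IV.9.4 and Table 4.1] -/
theorem hasAdditiveReductionAt_of_kodairaSymbolAt_eq_IIstar (hk : k ≠ 0)
    (h : (mordellCurve (k : ℚ)).kodairaSymbolAt v = .IIstar) :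
    (mordellCurve (k : ℚ)).HasAdditiveReductionAt v := by
  haveI := isElliptic_mordellCurve (Int.cast_ne_zero.mpr hk : (k : ℚ) ≠ 0)
  haveI : PerfectField (IsLocalRing.ResidueField (v.adicCompletionIntegers ℚ)) := PerfectField.ofFinite
  refine (WeierstrassCurve.isAdditive_kodairaSymbolAt_iff_holds v (mordellCurve (k : ℚ))).mp ?_
  rw [h]
  exact ⟨by simp [KodairaSymbol.IsGood], by simp [KodairaSymbol.IsMultiplicative]⟩

/-- **`E^k` has additive reduction at `3` when `3⁵ ∥ k`** (Kodaira type `II*` at `3`: Rizzo's Table II, the tree's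
`kodairaSymbolAt_three_of_mordell_five`). [cite: SilvermanATAEC1994, IV.9.4 Step 10 and Table 4.1] -/
theorem hasAdditiveReductionAt_three_of_dvd (hk : k ≠ 0) (hv : natGenerator v = 3) (h5 : (3 : ℤ) ^ 5 ∣ k)
    (h6 : ¬ (3 : ℤ) ^ 6 ∣ k) : (mordellCurve (k : ℚ)).HasAdditiveReductionAt v := by
  haveI := isElliptic_mordellCurve (Int.cast_ne_zero.mpr hk : (k : ℚ) ≠ 0)
  refine hasAdditiveReductionAt_of_kodairaSymbolAt_eq_IIstar v hk ?_
  refine Mordell.kodairaSymbolAt_three_of_mordell_five (mordellCurve (k : ℚ)) v (C := 1) (by rw [one_smul]; rfl) hk hv ?_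
  have h5' : k.natAbs.factorization 3 ≥ 5 := by
    have : 3 ^ 5 ∣ k.natAbs := by
      have := Int.natAbs_dvd_natAbs.mpr h5
      simpa using this
    exact (Nat.Prime.pow_dvd_iff_le_factorization Nat.prime_three (Int.natAbs_ne_zero.mpr hk)).mp this
  have h6' : ¬ k.natAbs.factorization 3 ≥ 6 := by
    intro h
    apply h6
    have : 3 ^ 6 ∣ k.natAbs := (Nat.Prime.pow_dvd_iff_le_factorization Nat.prime_three (Int.natAbs_ne_zero.mpr hk)).mpr h
    have := Int.natAbs_dvd_natAbs.mp (by simpa using this : ((3 : ℤ) ^ 6).natAbs ∣ k.natAbs)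
    exact this
  omega

/-- **`E^k` has additive reduction at `2` when `2⁵ ∥ k`** (type `II*` at `2`, the tree's
`kodairaSymbolAt_and_ordMinimalDiscriminant_mordell_five`). [cite: SilvermanATAEC1994, IV.9.4 and Table 4.1] -/
theorem hasAdditiveReductionAt_two_of_dvd (hk : k ≠ 0) (hv : natGenerator v = 2) (h5 : (2 : ℤ) ^ 5 ∣ k)
    (h6 : ¬ (2 : ℤ) ^ 6 ∣ k) : (mordellCurve (k : ℚ)).HasAdditiveReductionAt v := by
  haveI := isElliptic_mordellCurve (Int.cast_ne_zero.mpr hk : (k : ℚ) ≠ 0)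
  haveI : PerfectField (IsLocalRing.ResidueField (v.adicCompletionIntegers ℚ)) := PerfectField.ofFinite
  obtain ⟨u, rfl⟩ := h5
  have hu : ¬ (2 : ℤ) ∣ u := fun h ↦ h6 (by rw [pow_succ]; exact mul_dvd_mul_left _ h)
  refine hasAdditiveReductionAt_of_kodairaSymbolAt_eq_IIstar v (k := 2 ^ 5 * u) (by simpa using hk) ?_
  exact (WeierstrassCurve.kodairaSymbolAt_and_ordMinimalDiscriminant_mordell_five v hv (mordellCurve ((2 ^ 5 * u : ℤ) : ℚ)) rfl rfl rfl rfl
    (u := u) hu (by simp [mordellCurve])).1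

/-- **`E^k` has additive reduction at `2` when `k = 16u`, `u ≡ 3 (mod 4)`** (type `II*` at `2`, the tree's
`kodairaSymbolAt_and_ordMinimalDiscriminant_mordell_four_of_emod_four_eq_three`). [cite: SilvermanATAEC1994, IV.9.4 and Table 4.1] -/
theorem hasAdditiveReductionAt_two_of_eq_sixteen_mul (hv : natGenerator v = 2) {u : ℤ} (hu : u % 4 = 3)
    (hk : k = 16 * u) : (mordellCurve (k : ℚ)).HasAdditiveReductionAt v := by
  have hk0 : k ≠ 0 := by rw [hk]; omega
  haveI := isElliptic_mordellCurve (Int.cast_ne_zero.mpr hk0 : (k : ℚ) ≠ 0)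
  haveI : PerfectField (IsLocalRing.ResidueField (v.adicCompletionIntegers ℚ)) := PerfectField.ofFinite
  refine hasAdditiveReductionAt_of_kodairaSymbolAt_eq_IIstar v hk0 ?_
  exact (WeierstrassCurve.kodairaSymbolAt_and_ordMinimalDiscriminant_mordell_four_of_emod_four_eq_three v hv (mordellCurve (k : ℚ))
    rfl rfl rfl rfl hu (by simp [mordellCurve, hk])).1

/-- **`a_{p^{j+1}}(W) = 0` at a prime of additive reduction** (Euler factor `1`; generic `W / ℚ`).
[cite: SilvermanAEC2009, §C.16 (definition of L_v(T))] [cite: DiamondShurman2005, §8.8 (8.44)] -/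
theorem lFunction_apply_prime_pow_of_hasAdditiveReductionAt (W : WeierstrassCurve ℚ)
    (hadd : W.HasAdditiveReductionAt v) (j : ℕ) : W.LFunction (natGenerator v ^ (j + 1)) = 0 := by
  have h1 : W.LFunction (natGenerator v) = 0 := lFunction_apply_eq_zero_of_hasAdditiveReductionAt v _ hadd
  induction j using Nat.strong_induction_on with
  | _ j ih =>
    rcases j with _ | j
    · rw [zero_add, pow_one]; exact h1
    · have h := W.LFunction_apply_prime_pow_add_two v j
      rw [if_neg hadd.not_hasGoodReductionAt] at h
      change W.LFunction (natGenerator v ^ (j + 2)) = W.LFunction (natGenerator v) * _ - 0 * _ at h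
      rw [h1, zero_mul, zero_mul, sub_zero] at h
      exact h

/-- The finite place of `ℚ` under a rational prime. [folklore] -/
private theorem exists_natGenerator_eq {p : ℕ} (hp : p.Prime) : ∃ v : HeightOneSpectrum (𝓞 ℚ), natGenerator v = p :=
  ⟨primesEquiv.symm ⟨p, hp⟩, congrArg Subtype.val ((primesEquiv (R := 𝓞 ℚ)).apply_symm_apply ⟨p, hp⟩)⟩

/-- **The additive Euler factors of `L(E^k, s)`, summary** (`k ≠ 0` sixth-power-free): `a_{p^{j+1}}(E^k) = 0` for `p = 3`,
for every prime `p ≥ 5` dividing `k`, and for `p = 2` unless `k = 16u` with `u ≡ 1 (mod 4)`.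
[cite: IrelandRosen1990, Ch. 18 §7 («if `P ∣ 6D` then `χ(P) = 0`»)] [cite: SilvermanAEC2009, §C.16] -/
theorem lFunction_apply_prime_pow_eq_zero (hk : k ≠ 0) (h6 : ∀ q : ℕ, q.Prime → ¬ (q : ℤ) ^ 6 ∣ k) {p : ℕ}
    (hp : p.Prime) (hcase : p = 3 ∨ (5 ≤ p ∧ (p : ℤ) ∣ k) ∨ (p = 2 ∧ ¬ ∃ u : ℤ, u % 4 = 1 ∧ k = 16 * u)) (j : ℕ) :
    (mordellCurve (k : ℚ)).LFunction (p ^ (j + 1)) = 0 := by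
  obtain ⟨v, hv⟩ := exists_natGenerator_eq hp
  rw [← hv]
  refine lFunction_apply_prime_pow_of_hasAdditiveReductionAt v _ ?_ j
  rcases hcase with rfl | ⟨h5, hpk⟩ | ⟨rfl, hno⟩
  · by_cases h35 : (3 : ℤ) ^ 5 ∣ k
    · exact hasAdditiveReductionAt_three_of_dvd v hk hv h35 (by exact_mod_cast h6 3 Nat.prime_three)
    · exact hasAdditiveReductionAt_three_of_not_dvd v hk hv h35
  · rw [← hv] at h5 hpk
    exact hasAdditiveReductionAt_of_five_le v hk h5 hpk (by rw [hv]; exact_mod_cast h6 p hp)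
  · by_cases h24 : (2 : ℤ) ^ 4 ∣ k
    · by_cases h25 : (2 : ℤ) ^ 5 ∣ k
      · exact hasAdditiveReductionAt_two_of_dvd v hk hv h25 (by exact_mod_cast h6 2 Nat.prime_two)
      · obtain ⟨u, rfl⟩ := h24
        have hu2 : ¬ (2 : ℤ) ∣ u := fun h ↦ h25 (by rw [pow_succ]; exact mul_dvd_mul_left _ h)
        have hu4 : u % 4 = 3 := by
          rcases Int.emod_two_eq_zero_or_one u with h | h
          · exact absurd (Int.dvd_of_emod_eq_zero h) hu2
          · have : u % 4 = 1 ∨ u % 4 = 3 := by omega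
            rcases this with h1 | h3
            · exact absurd ⟨u, h1, by norm_num⟩ hno
            · exact h3
        exact hasAdditiveReductionAt_two_of_eq_sixteen_mul v hv hu4 (by norm_num)
    · exact hasAdditiveReductionAt_two_of_not_dvd v hk hv h24

end Additive

/-! ### §3 The inert primes `p ≡ 2 (3)` and the good prime `2` of `y² = x³ + 16u`, `u ≡ 1 (4)` -/

section Inert

variable (v : HeightOneSpectrum (𝓞 ℚ))

/-- **A supersingular Euler factor `(1 + p^{1−2s})⁻¹`**: if `W` has good reduction at `p` with `a_p(W) = 0`, then
`a_{p^{2m}}(W) = (−p)^m` and `a_{p^{2m+1}}(W) = 0` (the recursion `a_{p^{j+2}} = a_p a_{p^{j+1}} − p a_{p^j}`; generic `W / ℚ`).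
[cite: DiamondShurman2005, §8.8 (8.44)] [cite: IrelandRosen1990, Ch. 18 §7 («`1 + p^{1−2s} = 1 − χ(P)N(P)^{−s}`, `χ((p)) = −p`»)] -/
theorem lFunction_apply_prime_pow_of_apply_prime_eq_zero (W : WeierstrassCurve ℚ) (hgood : W.HasGoodReductionAt v)
    (h0 : W.LFunction (natGenerator v) = 0) (m : ℕ) :
    W.LFunction (natGenerator v ^ (2 * m)) = (-(natGenerator v : ℤ)) ^ m ∧
      W.LFunction (natGenerator v ^ (2 * m + 1)) = 0 := by
  have hrec : ∀ j, W.LFunction (natGenerator v ^ (j + 2)) = -(natGenerator v : ℤ) * W.LFunction (natGenerator v ^ j) := by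
    intro j
    have h := W.LFunction_apply_prime_pow_add_two v j
    rw [if_pos hgood] at h
    change W.LFunction (natGenerator v ^ (j + 2)) =
      W.LFunction (natGenerator v) * _ - (natGenerator v : ℤ) * W.LFunction (natGenerator v ^ j) at h
    rw [h, h0, zero_mul, zero_sub]; ring
  induction m with
  | zero =>
    refine ⟨?_, ?_⟩
    · rw [mul_zero, pow_zero, pow_zero]; exact W.isMultiplicative_LFunction.map_one
    · rw [mul_zero, zero_add, pow_one]; exact h0
  | succ m ih =>
    refine ⟨?_, ?_⟩
    · rw [show 2 * (m + 1) = 2 * m + 2 by ring, hrec, ih.1]; ring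
    · rw [show 2 * (m + 1) + 1 = (2 * m + 1) + 2 by ring, hrec, ih.2]; ring

/-- `E^k` has good reduction at every prime `p ∤ 6k` (place form of the tree's `hasGoodReductionAtPrime_mordellCurve`).
[cite: IrelandRosen1990, Ch. 18 §3 (PDF p. 298)] -/
theorem hasGoodReductionAt_of_not_dvd (h2 : natGenerator v ≠ 2) (h3 : natGenerator v ≠ 3) (hpk : ¬ (natGenerator v : ℤ) ∣ k) :
    (mordellCurve (k : ℚ)).HasGoodReductionAt v := by
  rw [← map_mordellCurve_intCast]
  exact hasGoodReductionAt_map_of_not_dvd _ v (not_dvd_mordellCurve_Δ (prime_natGenerator v) h2 h3 hpk)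

/-- **The inert Euler factors of `L(E^k, s)`**: for a prime `p ≡ 2 (mod 3)`, `p ≠ 2`, `p ∤ k`: `a_{p^{2m}}(E^k) = (−p)^m` and
`a_{p^{2m+1}}(E^k) = 0` (`a_p = 0`: Ireland–Rosen Thm. 18.4, first case — the tree's `lFunction_mordellCurve_apply_prime_eq_zero`).
[cite: IrelandRosen1990, Ch. 18 §3 Theorem 4 (first assertion) and §7] [cite: DiamondShurman2005, §8.8 (8.44)] -/
theorem lFunction_apply_prime_pow_of_mod_three_eq_two {p : ℕ} (hp : p.Prime) (hp3 : p % 3 = 2) (hp2 : p ≠ 2)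
    (hpk : ¬ (p : ℤ) ∣ k) (m : ℕ) :
    (mordellCurve (k : ℚ)).LFunction (p ^ (2 * m)) = (-(p : ℤ)) ^ m ∧
      (mordellCurve (k : ℚ)).LFunction (p ^ (2 * m + 1)) = 0 := by
  obtain ⟨v, rfl⟩ := exists_natGenerator_eq hp
  have hp3' : natGenerator v ≠ 3 := by rintro h; rw [h] at hp3; norm_num at hp3
  exact lFunction_apply_prime_pow_of_apply_prime_eq_zero v _ (hasGoodReductionAt_of_not_dvd v hp2 hp3' hpk)
    (lFunction_mordellCurve_apply_prime_eq_zero hp hp3 hp2 hpk) m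

/-- The affine count over `𝔽₂`: `y² + y = x³ + c` has exactly two solutions for each `c ∈ 𝔽₂`. [folklore] -/
private theorem card_sq_add_self_eq_cube_add_two (c : ZMod 2) :
    Fintype.card {xy : ZMod 2 × ZMod 2 // xy.2 ^ 2 + xy.2 = xy.1 ^ 3 + c} = 2 := by
  revert c; decide

/-- **`#Ẽ(𝔽₂) = 3` for `Ẽ : y² + y = x³ + c` over `𝔽₂`** (the point at infinity and two affine points; `Δ = −27(1 + 4c)² = 1`
in `𝔽₂`, so every solution is nonsingular). [cite: SilvermanAEC2009, V.2 (a_p = p + 1 − #E(𝔽_p))] -/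
theorem natCard_point_two (c : ZMod 2) :
    Nat.card (⟨0, 0, 1, 0, c⟩ : WeierstrassCurve (ZMod 2)).toAffine.Point = 3 := by
  have hΔ1 : (⟨0, 0, 1, 0, c⟩ : WeierstrassCurve (ZMod 2)).Δ = -27 * (1 + 4 * c) ^ 2 := by
    simp only [WeierstrassCurve.Δ, WeierstrassCurve.b₂, WeierstrassCurve.b₄, WeierstrassCurve.b₆, WeierstrassCurve.b₈]
    ring
  have h4 : (4 : ZMod 2) = 0 := by decide
  have h27 : (-27 : ZMod 2) = 1 := by decide
  set E : WeierstrassCurve (ZMod 2) := ⟨0, 0, 1, 0, c⟩ with hE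
  have hΔ : E.Δ ≠ 0 := by
    rw [hE, hΔ1, h4, h27, zero_mul, add_zero, one_pow, mul_one]; exact one_ne_zero
  have e : E.toAffine.Point ≃ Option {xy : ZMod 2 × ZMod 2 // E.toAffine.Nonsingular xy.1 xy.2} :=
    WeierstrassCurve.Affine.nonsingularPointEquiv E.toAffine
  rw [Nat.card_congr e, Nat.card_eq_fintype_card, Fintype.card_option]
  have e1 : {xy : ZMod 2 × ZMod 2 // E.toAffine.Nonsingular xy.1 xy.2} ≃
      {xy : ZMod 2 × ZMod 2 // xy.2 ^ 2 + xy.2 = xy.1 ^ 3 + c} := by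
    refine Equiv.subtypeEquivRight fun xy => ?_
    rw [← WeierstrassCurve.Affine.equation_iff_nonsingular_of_Δ_ne_zero hΔ, WeierstrassCurve.Affine.equation_iff]
    simp only [hE, zero_mul, add_zero, one_mul]
  rw [Fintype.card_congr e1, card_sq_add_self_eq_cube_add_two]

/-- **`y² = x³ + 16u`, `u ≡ 1 (mod 4)`: `a_2(E^k) = 0`** — the model `(2; 0, 0, 4) • E^k = ⟨0, 0, 1, 0, (u−1)/4⟩` is `2`-integral
with odd discriminant `−27u²` (good reduction, the tree's `hasGoodReductionAt_mordell_four_of_emod_four_eq_one`), its reduction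
`y² + y = x³ + c` has `3` points over `𝔽₂`, and `a_n` is an invariant of the isomorphism class (`LFunction_smul`).
[cite: SilvermanAEC2009, VII.1 Remark 1.1, VII.5 Prop. 5.1(a), §C.16] -/
theorem lFunction_apply_two_of_eq_sixteen_mul {u : ℤ} (hu : u % 4 = 1) (hk : k = 16 * u) :
    (mordellCurve (k : ℚ)).LFunction 2 = 0 := by
  have hk0 : (k : ℚ) ≠ 0 := by
    have : k ≠ 0 := by rw [hk]; omega
    exact_mod_cast this
  haveI := isElliptic_mordellCurve hk0
  obtain ⟨q, hq⟩ : ∃ q : ℤ, u - 1 = 4 * q := ⟨(u - 1) / 4, by omega⟩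
  set C : WeierstrassCurve.VariableChange ℚ := ⟨⟨2, 2⁻¹, by norm_num, by norm_num⟩, 0, 0, 4⟩ with hC
  set Mz : WeierstrassCurve ℤ := ⟨0, 0, 1, 0, q⟩ with hMz
  have hM : C • mordellCurve (k : ℚ) = Mz.map (Int.castRingHom ℚ) := by
    have hu' : (u : ℚ) = 4 * q + 1 := by exact_mod_cast (show u = 4 * q + 1 by omega)
    rw [hMz, hk]
    ext
    · rw [hC, WeierstrassCurve.variableChange_a₁]; simp [mordellCurve]
    · rw [hC, WeierstrassCurve.variableChange_a₂]; simp [mordellCurve]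
    · rw [hC, WeierstrassCurve.variableChange_a₃]; simp [mordellCurve]; norm_num
    · rw [hC, WeierstrassCurve.variableChange_a₄]; simp [mordellCurve]
    · rw [hC, WeierstrassCurve.variableChange_a₆]; simp [mordellCurve]; rw [hu']; norm_num; ring
  have hΔ : ¬ (2 : ℤ) ∣ Mz.Δ := by
    have hΔ' : Mz.Δ = 1 + 2 * (-216 * q ^ 2 - 108 * q - 14) := by
      simp only [hMz, WeierstrassCurve.Δ, WeierstrassCurve.b₂, WeierstrassCurve.b₄, WeierstrassCurve.b₆,
        WeierstrassCurve.b₈]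
      ring
    rw [hΔ', Int.dvd_iff_emod_eq_zero, Int.add_mul_emod_self_left]
    decide
  rw [← (mordellCurve (k : ℚ)).LFunction_smul C, hM,
    Literature.NumberTheory.Automorphic.lFunction_map_apply_prime_of_not_dvd _ Nat.prime_two hΔ,
    Literature.NumberTheory.Automorphic.frobeniusTrace, Literature.NumberTheory.Automorphic.numPointsMod]
  have hmap : Mz.map (Int.castRingHom (ZMod 2)) = ⟨0, 0, 1, 0, (q : ZMod 2)⟩ := by
    rw [hMz]; simp [WeierstrassCurve.map]
  rw [hmap, natCard_point_two]
  norm_num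

/-- **The Euler factor at `2` of `y² = x³ + 16u`, `u ≡ 1 (mod 4)`, is `(1 + 2^{1−2s})⁻¹`**: `a_{4^m} = (−2)^m`, `a_{2·4^m} = 0`
(good supersingular reduction at the prime `2`, which is inert in `ℤ[ω]`: `χ((2)) = −2`).
[cite: IrelandRosen1990, Ch. 18 §7] [cite: DiamondShurman2005, §8.8 (8.44)] -/
theorem lFunction_apply_two_pow_of_eq_sixteen_mul {u : ℤ} (hu : u % 4 = 1) (hk : k = 16 * u) (m : ℕ) :
    (mordellCurve (k : ℚ)).LFunction (2 ^ (2 * m)) = (-(2 : ℤ)) ^ m ∧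
      (mordellCurve (k : ℚ)).LFunction (2 ^ (2 * m + 1)) = 0 := by
  obtain ⟨v, hv⟩ := exists_natGenerator_eq Nat.prime_two
  have hgood : (mordellCurve (k : ℚ)).HasGoodReductionAt v :=
    WeierstrassCurve.hasGoodReductionAt_mordell_four_of_emod_four_eq_one v hv _ rfl rfl rfl rfl hu
      (by simp [mordellCurve, hk])
  have h := lFunction_apply_prime_pow_of_apply_prime_eq_zero v _ hgood
    (by rw [hv]; exact lFunction_apply_two_of_eq_sixteen_mul hu hk) m
  rw [hv] at h
  exact_mod_cast h

end Inert

end SexticTwist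

end Literature.NumberTheory.EllipticCurves

end
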